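import Mathlib
import Summits.QuantumFields.YangMills.Theorems.ConvexGribovBodyContinuumLegGivenGapStubCsclKLevel
import Summits.QuantumFields.YangMills.Theorems.ConvexGribovBodyContinuumLegGivenGapStubCsclCore
import Summits.QuantumFields.YangMills.Theorems.ConvexGribovBodyContinuumLegGivenGapStubCsclCoreVar
import Summits.QuantumFields.YangMills.Theorems.ConvexGribovBodyContinuumLegGivenGapCsclReduce
import Summits.QuantumFields.YangMills.Theorems.ConvexGribovBodyContinuumLegGivenGapCsclScheme
import Summits.QuantumFields.YangMills.Theorems.ConvexGribovBodyContinuumLegGivenGapStubCsclSupport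
import Summits.QuantumFields.YangMills.Theorems.ConvexGribovBodyContinuumLegGivenGapStubCsclRate
import Summits.QuantumFields.YangMills.Theorems.ConvexGribovBodyContinuumLegGivenGapStubCsclEndgame
import Summits.QuantumFields.YangMills.Theorems.ParabolicTrajectoryContinuumLimitOnTrajectoryStubTranslB
import HarnessLib

/-!
# `ContinuumLegGivenGap` (stmt-QuantumFields-15828), line `Sketch`, reshape 18c: `stub_csclOfLock` — (CSCL) from the locked lattice gap

The registered assembly stub `stub_csclOfLock` of line `Sketch`: for locked IR data (`β_k → ∞`, rates `m̂_k > 0`, one constant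
per pair of local gauge-invariant observables on all tori `S ≥ S₁ k`), spacings `a_k > 0` with `Δ₀ a_k ≤ m̂_{φ k}`, `m̂ → 0`, cofinal
admissible volume sets `𝓛 k` above the thresholds with polynomial growth, and the (UUVB) inequality for every canonically normalised
exactly centred scheme with these data, there is such a scheme whose canonical scheme has Cauchy–Schwarz clustering at rate `Δ₀/2`.
Assembly: per `k`, the torus `L_k ∈ 𝓛 k` is chosen by the uniform k-level theorem `stub_csclKLevel` (tolerance `1/(k+1)`,
complexity `≤ k`, shifts `≤ ⌈k/a_k⌉₊`, `L_k ≥ k`; any admissible torus while `β(φ k) < 0`) — `csclOfLock_choice`; the scheme is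
`cscl_mkScheme` (`a_k → 0` from `Δ₀ a_k ≤ m̂(φ k) → 0`, `a_k L_k → ∞` by `cscl_tendsto_mul_of_pow`); `HasCSClustering` is reduced to
the sums inequality by `cscl_hasCSClustering_of_sums`; per datum: one positive ordered slab for both finite sums (`stub_csclSupport`),
matching and rounding (`stub_csclCore`, `stub_csclCoreVar`), the k-level bound, the rate comparison (`stub_csclRate`), the k-uniform
E0′ bound from (UUVB) (`Transl.norm_curvDistribution_le_of_uuvb`) and the real-variable endgame (`stub_csclEndgame`).
No definitions, no facts; Mathlib + landed tree lemmas only. [folklore]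
-/

noncomputable section

namespace Summit.QuantumFields.YangMills.Theorems.ContinuumLegGivenGap

open scoped SchwartzMap ComplexConjugate
open Filter Topology MeasureTheory
open Literature.MathematicalPhysics.QuantumFieldTheory Literature.MathematicalPhysics.QuantumLattice
  Literature.MathematicalPhysics.AQFT Literature.Probability.LatticeModels
open Summit.QuantumFields.YangMills.Cruxes.ContinuumLimitOnTrajectory.TwoOrbitSynchronisation

section Helpers

variable {G : Type} [Group G] [TopologicalSpace G] [IsTopologicalGroup G] [CompactSpace G]
  [MeasurableSpace G] [BorelSpace G]

omit [Group G] [TopologicalSpace G] [IsTopologicalGroup G] [CompactSpace G] [MeasurableSpace G] [BorelSpace G] in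
/-- Monotonicity of the positive ordered time slab in its margin and height. [folklore] -/
theorem csclOfLock_slab_mono {p : ℕ} {δ δ' T T' : ℝ} (hδ : δ' ≤ δ) (hT : T ≤ T') :
    ({x | (∀ i, δ ≤ x i 0 ∧ x i 0 ≤ T) ∧ ∀ i i', i < i' → x i 0 + δ ≤ x i' 0} :
        Set (Fin p → EuclideanSpace ℝ (Fin 4))) ⊆
      {x | (∀ i, δ' ≤ x i 0 ∧ x i 0 ≤ T') ∧ ∀ i i', i < i' → x i 0 + δ' ≤ x i' 0} :=
  fun _ hx => ⟨fun i => ⟨hδ.trans (hx.1 i).1, (hx.1 i).2.trans hT⟩, fun i i' h => by linarith [hx.2 i i' h]⟩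

omit [Group G] [TopologicalSpace G] [IsTopologicalGroup G] [CompactSpace G] [MeasurableSpace G] [BorelSpace G] in
/-- A test function supported in a positive ordered time slab is time-ordered. [folklore] -/
theorem csclOfLock_isTimeOrdered {p : ℕ} {F : 𝓢((Fin p → EuclideanSpace ℝ (Fin 4)), ℂ)} {δ T : ℝ} (hδ : 0 < δ)
    (hF : tsupport (F : (Fin p → EuclideanSpace ℝ (Fin 4)) → ℂ) ⊆
      {x | (∀ i, δ ≤ x i 0 ∧ x i 0 ≤ T) ∧ ∀ i i', i < i' → x i 0 + δ ≤ x i' 0}) : IsTimeOrdered F := by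
  intro x hx
  have h := hF hx
  refine ⟨fun i => hδ.trans_le (h.1 i).1, ?_⟩
  intro i j hij
  have := h.2 i j hij
  dsimp only
  linarith

/-- The budget of the variance matchings: with `M = √BF + √BH + 1` and `ε₂ = min (ε/8) ((ε/(8M))²)`,
`√ε₂ (√BF + √BH) + ε₂ ≤ ε/4`. [folklore] -/
theorem csclOfLock_eps2 {BF BH ε : ℝ} (hε : 0 < ε) :
    0 < min (ε / 8) ((ε / (8 * (Real.sqrt BF + Real.sqrt BH + 1))) ^ 2) ∧
    Real.sqrt (min (ε / 8) ((ε / (8 * (Real.sqrt BF + Real.sqrt BH + 1))) ^ 2)) * (Real.sqrt BF + Real.sqrt BH) +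
        min (ε / 8) ((ε / (8 * (Real.sqrt BF + Real.sqrt BH + 1))) ^ 2) ≤ ε / 4 := by
  set M : ℝ := Real.sqrt BF + Real.sqrt BH + 1 with hM
  have hM1 : 1 ≤ M := by simp only [hM]; linarith [Real.sqrt_nonneg BF, Real.sqrt_nonneg BH]
  have hM0 : 0 < M := by linarith
  have hq : 0 < ε / (8 * M) := by positivity
  refine ⟨lt_min (by positivity) (pow_pos hq 2), ?_⟩
  set ε₂ : ℝ := min (ε / 8) ((ε / (8 * M)) ^ 2) with hε₂
  have hs : Real.sqrt ε₂ ≤ ε / (8 * M) := by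
    calc Real.sqrt ε₂ ≤ Real.sqrt ((ε / (8 * M)) ^ 2) := Real.sqrt_le_sqrt (min_le_right _ _)
      _ = ε / (8 * M) := Real.sqrt_sq hq.le
  have hsum : Real.sqrt BF + Real.sqrt BH = M - 1 := by simp only [hM]; ring
  have h1 : Real.sqrt ε₂ * (Real.sqrt BF + Real.sqrt BH) ≤ ε / 8 := by
    rw [hsum]
    calc Real.sqrt ε₂ * (M - 1) ≤ ε / (8 * M) * (M - 1) := mul_le_mul_of_nonneg_right hs (by linarith)
      _ ≤ ε / (8 * M) * M := mul_le_mul_of_nonneg_left (by linarith) hq.le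
      _ = ε / 8 := by field_simp
  have h2 : ε₂ ≤ ε / 8 := min_le_left _ _
  linarith

/-- **The per-level torus choice**: at one coupling, a torus `L ∈ 𝓛`, `L ≥ Lmin`, carrying the uniform k-level Cauchy–Schwarz
bound of `stub_csclKLevel` whenever `β ≥ 0` (any admissible torus otherwise). [folklore] -/
theorem csclOfLock_choice (r : LatticeRep G) (β μ a : ℝ) (S₁ : ℕ) (𝓛 : Set ℕ) (hμ : 0 < μ) (ha : 0 < a)
    (hcof : ∀ S : ℕ, ∃ S' : ℕ, S' ∈ 𝓛 ∧ S ≤ S') (hS₁ : ∀ S ∈ 𝓛, S₁ ≤ S)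
    (hlock : ∀ A B : YMSpecies G, ∃ C : ℝ, ∀ S n : ℕ, S₁ ≤ S → n ≤ S →
      |latticeConnectedCorr r.ρ β (2 * S + 1) A.F B.F n| ≤ C * Real.exp (-(μ * n)))
    (τ : ℝ) (Nmax σmax Lmin : ℕ) (hτ : 0 < τ) :
    ∃ L : ℕ, L ∈ 𝓛 ∧ Lmin ≤ L ∧ (0 ≤ β →
        ∀ (n m : ℕ) (F : SchwartzMap (Fin n → EuclideanSpace ℝ (Fin 4)) ℂ)
          (H : SchwartzMap (Fin m → EuclideanSpace ℝ (Fin 4)) ℂ) (T : ℝ), n ≤ Nmax → m ≤ Nmax →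
          tsupport (F : (Fin n → EuclideanSpace ℝ (Fin 4)) → ℂ) ⊆ {x | ∀ i, a ≤ x i 0 ∧ x i 0 ≤ T} →
          tsupport (H : (Fin m → EuclideanSpace ℝ (Fin 4)) → ℂ) ⊆ {x | ∀ i, a ≤ x i 0 ∧ x i 0 ≤ T} →
          ∀ σ : ℕ, σ ≤ σmax →
            ‖((∫ U : GaugeConfig 4 (2 * L + 1) G, (starRingEnd ℂ) ((fun V => ∑ x : Fin n → ↥(box 4 L), F (fun i => a • siteToE ↑(x i)) * ∏ i, ((r.curvature.F (configShift (-↑(x i)) V) - (wilsonTorusMean r.ρ β L r.curvature.F) : ℝ) : ℂ)) (cfgReflect (torusLift (2 * L + 1) U))) * (fun V => ∑ x : Fin m → ↥(box 4 L), H (fun i => a • siteToE ↑(x i)) * ∏ i, ((r.curvature.F (configShift (-↑(x i)) V) - (wilsonTorusMean r.ρ β L r.curvature.F) : ℝ) : ℂ)) (configShift (-(Pi.single 0 ((σ : ℕ) : ℤ))) (torusLift (2 * L + 1) U)) ∂(wilsonMeasure r.ρ β)) - (starRingEnd ℂ) (∫ U : GaugeConfig 4 (2 * L + 1) G, (fun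 V => ∑ x : Fin n → ↥(box 4 L), F (fun i => a • siteToE ↑(x i)) * ∏ i, ((r.curvature.F (configShift (-↑(x i)) V) - (wilsonTorusMean r.ρ β L r.curvature.F) : ℝ) : ℂ)) (torusLift (2 * L + 1) U) ∂(wilsonMeasure r.ρ β)) * (∫ U : GaugeConfig 4 (2 * L + 1) G, (fun V => ∑ x : Fin m → ↥(box 4 L), H (fun i => a • siteToE ↑(x i)) * ∏ i, ((r.curvature.F (configShift (-↑(x i)) V) - (wilsonTorusMean r.ρ β L r.curvature.F) : ℝ) : ℂ)) (torusLift (2 * L + 1) U) ∂(wilsonMeasure r.ρ β)))‖ ≤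
              Real.exp (-(μ * σ)) * Real.sqrt ‖∫ U : GaugeConfig 4 (2 * L + 1) G, (starRingEnd ℂ) ((fun V => ∑ x : Fin n → ↥(box 4 L), F (fun i => a • siteToE ↑(x i)) * ∏ i, ((r.curvature.F (configShift (-↑(x i)) V) - (wilsonTorusMean r.ρ β L r.curvature.F) : ℝ) : ℂ)) (cfgReflect (torusLift (2 * L + 1) U))) * (fun V => ∑ x : Fin n → ↥(box 4 L), F (fun i => a • siteToE ↑(x i)) * ∏ i, ((r.curvature.F (configShift (-↑(x i)) V) - (wilsonTorusMean r.ρ β L r.curvature.F) : ℝ) : ℂ)) (configShift (-(Pi.single 0 ((0 : ℕ) : ℤ))) (torusLift (2 * L + 1) U)) ∂(wilsonMeasure r.ρ β)‖ *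
                Real.sqrt ‖∫ U : GaugeConfig 4 (2 * L + 1) G, (starRingEnd ℂ) ((fun V => ∑ x : Fin m → ↥(box 4 L), H (fun i => a • siteToE ↑(x i)) * ∏ i, ((r.curvature.F (configShift (-↑(x i)) V) - (wilsonTorusMean r.ρ β L r.curvature.F) : ℝ) : ℂ)) (cfgReflect (torusLift (2 * L + 1) U))) * (fun V => ∑ x : Fin m → ↥(box 4 L), H (fun i => a • siteToE ↑(x i)) * ∏ i, ((r.curvature.F (configShift (-↑(x i)) V) - (wilsonTorusMean r.ρ β L r.curvature.F) : ℝ) : ℂ)) (configShift (-(Pi.single 0 ((0 : ℕ) : ℤ))) (torusLift (2 * L + 1) U)) ∂(wilsonMeasure r.ρ β)‖ +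
              τ * schwartzNorm (8 * n) F * schwartzNorm (8 * m) H) := by
  by_cases hb : 0 ≤ β
  · obtain ⟨L, hL, hLmin, h⟩ := stub_csclKLevel G r β μ a S₁ 𝓛 hb hμ ha hcof hS₁ hlock τ Nmax σmax Lmin hτ
    exact ⟨L, hL, hLmin, fun _ => h⟩
  · obtain ⟨L, hL, hLmin⟩ := hcof Lmin
    exact ⟨L, hL, hLmin, fun h => absurd h hb⟩

end Helpers

/-- **`stub_csclOfLock`** (registered assembly stub of line `Sketch`): (CSCL) of the canonical scheme from the locked lattice
gap, the scheme's torus chosen per level by the uniform k-level theorem. [folklore] -/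
theorem stub_csclOfLock :
    ∀ (G : Type) [Group G] [TopologicalSpace G] [IsTopologicalGroup G] [CompactSpace G]
      [MeasurableSpace G] [BorelSpace G] (r : LatticeRep G) (β mh : ℕ → ℝ) (S₁ : ℕ → ℕ)
      (a : ℕ → ℝ) (φ : ℕ → ℕ) (Δ₀ : ℝ) (𝓛 : ℕ → Set ℕ),
      Tendsto β atTop atTop → (∀ k, 0 < mh k) →
      (∀ A B : YMSpecies G, ∃ C : ℝ, ∀ k S n : ℕ, S₁ k ≤ S → n ≤ S →
        |latticeConnectedCorr r.ρ (β k) (2 * S + 1) A.F B.F n| ≤ C * Real.exp (-(mh k * n))) →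
      (∀ k, 0 < a k) → StrictMono φ → 0 < Δ₀ → (∀ k, Δ₀ * a k ≤ mh (φ k)) → Tendsto mh atTop (𝓝 0) →
      (∀ k S : ℕ, ∃ S' : ℕ, S' ∈ 𝓛 k ∧ S ≤ S') → (∀ k : ℕ, ∀ S ∈ 𝓛 k, S₁ (φ k) ≤ S) →
      (∃ N : ℕ, 1 ≤ N ∧ ∀ᶠ k in atTop, ∀ S ∈ 𝓛 k, (a k)⁻¹ ≤ (a k * (S : ℝ)) ^ N) →
      (∀ (sch : SpeciesScheme (YMSpecies G)), (∀ k, sch.a k = a k) → (∀ k, sch.β k = β (φ k)) →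
        (∀ k, sch.L k ∈ 𝓛 k) →
        (∀ k : ℕ, sch.m r.curvature k =
          ∫ U : GaugeConfig 4 (sch.side k) G, r.curvature.F (torusLift (sch.side k) U) ∂(wilsonMeasure r.ρ (sch.β k))) →
        (∀ k : ℕ, sch.c r.curvature k = (sch.a k ^ 4)⁻¹) →
        (∃ (s : ℕ) (α β' : ℝ), ∀ᶠ k in atTop, ∀ (p : ℕ) (q : Fin p → {q : Fin 4 × Fin 4 // q.1 < q.2})
          (F : SchwartzMap (Fin p → EuclideanSpace ℝ (Fin 4)) ℂ), IsOffDiagonal F →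
          ‖∫ U : GaugeConfig 4 (sch.side k) G, ∑ x : Fin p → ↥(box 4 (sch.L k)),
              F (fun i => sch.a k • siteToE ↑(x i)) *
                ∏ i, ((plaquetteObs r.ρ 0 (q i).1.1 (q i).1.2 (configShift (-↑(x i)) (torusLift (sch.side k) U)) -
                  wilsonTorusMean r.ρ (sch.β k) (sch.L k) (plaquetteObs r.ρ 0 (q i).1.1 (q i).1.2) : ℝ) : ℂ)
              ∂(wilsonMeasure r.ρ (sch.β k))‖ ≤ α * (p.factorial : ℝ) ^ β' * schwartzNorm (p * s) F)) →
      ∃ sch : SpeciesScheme (YMSpecies G), (∀ k, sch.a k = a k) ∧ (∀ k, sch.β k = β (φ k)) ∧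
        (∀ k, sch.L k ∈ 𝓛 k) ∧ (∀ k : ℕ, sch.c r.curvature k = (sch.a k ^ 4)⁻¹) ∧
        (∀ k : ℕ, sch.m r.curvature k =
          ∫ U : GaugeConfig 4 (sch.side k) G, r.curvature.F (torusLift (sch.side k) U) ∂(wilsonMeasure r.ρ (sch.β k))) ∧
        ∃ Δ₁ : ℝ, 0 < Δ₁ ∧ SpeciesScheme.HasCSClustering r (canon r sch) Δ₁ := by
  intro G _ _ _ _ _ _ r β mh S₁ a φ Δ₀ 𝓛 hβ hmh hlock ha hφ hΔ₀ hΔa hmh0 hcof h𝓛S₁ hpoly hU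
  -- the lock at level `φ k`
  have hlockk : ∀ (k : ℕ) (A B : YMSpecies G), ∃ C : ℝ, ∀ S n : ℕ, S₁ (φ k) ≤ S → n ≤ S →
      |latticeConnectedCorr r.ρ (β (φ k)) (2 * S + 1) A.F B.F n| ≤ C * Real.exp (-(mh (φ k) * n)) :=
    fun k A B => (hlock A B).imp fun C hC S n hS hn => hC (φ k) S n hS hn
  -- `a_k → 0`
  have ha0 : Tendsto a atTop (𝓝 0) := by
    have hmφ : Tendsto (fun k => mh (φ k) / Δ₀) atTop (𝓝 0) := by
      simpa using (hmh0.comp hφ.tendsto_atTop).div_const Δ₀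
    refine squeeze_zero (fun k => (ha k).le) (fun k => ?_) hmφ
    rw [le_div_iff₀ hΔ₀]
    linarith [hΔa k]
  -- the per-level torus
  choose L hL𝓛 hLk hKL using fun k : ℕ => csclOfLock_choice r (β (φ k)) (mh (φ k)) (a k) (S₁ (φ k)) (𝓛 k)
    (hmh _) (ha k) (hcof k) (h𝓛S₁ k) (hlockk k) (1 / ((k : ℝ) + 1)) k ⌈(k : ℝ) / a k⌉₊ k (by positivity)
  -- `a_k L_k → ∞`
  obtain ⟨N, hN1, hpolyN⟩ := hpoly
  have hLt : Tendsto (fun k => a k * (L k : ℝ)) atTop atTop :=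
    cscl_tendsto_mul_of_pow hN1 ha ha0 (hpolyN.mono fun k hk => hk (L k) (hL𝓛 k))
  -- the scheme
  obtain ⟨sch, hsa, hsβ, hsL, hsc, hsm⟩ := cscl_mkScheme r ha ha0 (fun k => β (φ k)) hLt
  have hsL𝓛 : ∀ k, sch.L k ∈ 𝓛 k := fun k => by rw [hsL k]; exact hL𝓛 k
  refine ⟨sch, hsa, hsβ, hsL𝓛, hsc, hsm, Δ₀ / 2, half_pos hΔ₀, ?_⟩
  have hUs := hU sch hsa hsβ hsL𝓛 hsm hsc
  -- the `k`-uniform E0′ bound on `⁰𝒮`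
  have hUUVB : UUVB r sch := by
    obtain ⟨s, α, β', hev⟩ := hUs
    exact ⟨s, α, β', hev.mono fun k hk p q Fx hFx => (hk p q Fx hFx).trans le_rfl⟩
  obtain ⟨s₁, α₁, β₁, hD⟩ := Transl.norm_curvDistribution_le_of_uuvb r sch hUUVB
  refine cscl_hasCSClustering_of_sums r sch fun n m hn hm N₁ N₁' c c' g g' p q hg hp hg' hq t ht ε hε => ?_
  -- one positive ordered slab for both sums
  obtain ⟨δF, TF, hδF, hFs⟩ := stub_csclSupport n N₁ c g p hg hp
  obtain ⟨δH, TH, hδH, hHs⟩ := stub_csclSupport m N₁' c' g' q hg' hq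
  set F : 𝓢((Fin n → EuclideanSpace ℝ (Fin 4)), ℂ) := ∑ i, c i • g i with hFdef
  set H : 𝓢((Fin m → EuclideanSpace ℝ (Fin 4)), ℂ) := ∑ j, c' j • g' j with hHdef
  set δ : ℝ := min δF δH with hδdef
  set T₀ : ℝ := max TF TH with hT₀def
  have hδ : 0 < δ := lt_min hδF hδH
  have hF : tsupport (F : (Fin n → EuclideanSpace ℝ (Fin 4)) → ℂ) ⊆
      {x | (∀ i, δ ≤ x i 0 ∧ x i 0 ≤ T₀) ∧ ∀ i i', i < i' → x i 0 + δ ≤ x i' 0} :=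
    hFs.trans (csclOfLock_slab_mono (min_le_left _ _) (le_max_left _ _))
  have hH : tsupport (H : (Fin m → EuclideanSpace ℝ (Fin 4)) → ℂ) ⊆
      {x | (∀ i, δ ≤ x i 0 ∧ x i 0 ≤ T₀) ∧ ∀ i i', i < i' → x i 0 + δ ≤ x i' 0} :=
    hHs.trans (csclOfLock_slab_mono (min_le_right _ _) (le_max_right _ _))
  have hFF : IsOffDiagonal ((osAdjoint F).appendTensor F) :=
    OSReconstructionNoE1.isOffDiagonal_appendTensor_osAdjoint (csclOfLock_isTimeOrdered hδ hF)
      (csclOfLock_isTimeOrdered hδ hF)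
  have hHH : IsOffDiagonal ((osAdjoint H).appendTensor H) :=
    OSReconstructionNoE1.isOffDiagonal_appendTensor_osAdjoint (csclOfLock_isTimeOrdered hδ hH)
      (csclOfLock_isTimeOrdered hδ hH)
  -- the uniform bounds and the tolerance of the variance matchings
  set BF : ℝ := (Fintype.card PlaqIdx : ℝ) ^ (n + n) *
    (α₁ * ((n + n).factorial : ℝ) ^ β₁ * schwartzNorm ((n + n) * s₁) ((osAdjoint F).appendTensor F)) with hBF
  set BH : ℝ := (Fintype.card PlaqIdx : ℝ) ^ (m + m) *
    (α₁ * ((m + m).factorial : ℝ) ^ β₁ * schwartzNorm ((m + m) * s₁) ((osAdjoint H).appendTensor H)) with hBH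
  obtain ⟨hε₂, hbud₂⟩ := csclOfLock_eps2 (BF := BF) (BH := BH) hε
  set ε₂ : ℝ := min (ε / 8) ((ε / (8 * (Real.sqrt BF + Real.sqrt BH + 1))) ^ 2) with hε₂def
  -- matching and rounding, the variances, the rate
  have h1 := stub_csclCore G r sch n m F H δ T₀ t hδ ht hF hH hUs (ε / 4) (by positivity)
  have h2 := stub_csclCoreVar G r sch n F δ T₀ hδ hF hUs ε₂ hε₂
  have h3 := stub_csclCoreVar G r sch m H δ T₀ hδ hH hUs ε₂ hε₂
  have h4 := stub_csclRate a (fun k => mh (φ k)) Δ₀ t hΔ₀ ht ha ha0 hΔa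
  -- eventual side conditions of the k-level theorem
  have h5 : ∀ᶠ k : ℕ in atTop, 0 ≤ β (φ k) := (hβ.comp hφ.tendsto_atTop).eventually (eventually_ge_atTop 0)
  have h6 : ∀ᶠ k : ℕ in atTop, max n m ≤ k := eventually_ge_atTop _
  have h7 : ∀ᶠ k : ℕ in atTop, t ≤ (k : ℝ) := by
    obtain ⟨K, hK⟩ := exists_nat_ge t
    filter_upwards [eventually_ge_atTop K] with k hk
    exact hK.trans (by exact_mod_cast hk)
  have h8 : ∀ᶠ k : ℕ in atTop, a k ≤ δ := ha0.eventually (eventually_le_nhds hδ)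
  have h9 : ∀ᶠ k : ℕ in atTop, 1 / ((k : ℝ) + 1) * schwartzNorm (8 * n) F * schwartzNorm (8 * m) H ≤ ε / 4 := by
    have h : Tendsto (fun k : ℕ => 1 / ((k : ℝ) + 1) * schwartzNorm (8 * n) F * schwartzNorm (8 * m) H) atTop
        (𝓝 (0 * schwartzNorm (8 * n) F * schwartzNorm (8 * m) H)) :=
      (tendsto_one_div_add_atTop_nhds_zero_nat.mul_const _).mul_const _
    rw [zero_mul, zero_mul] at h
    exact h.eventually (eventually_le_nhds (by positivity))
  filter_upwards [h1, h2, h3, h4, h5, h6, h7, h8, h9, hD] with k hk1 hk2 hk3 hk4 hk5 hk6 hk7 hk8 hk9 hDk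
  -- the k-level bound at the scheme's torus
  have hσ : ⌊t / a k⌋₊ ≤ ⌈(k : ℝ) / a k⌉₊ :=
    (Nat.floor_mono (div_le_div_of_nonneg_right hk7 (ha k).le)).trans (Nat.floor_le_ceil _)
  have hFk : tsupport (F : (Fin n → EuclideanSpace ℝ (Fin 4)) → ℂ) ⊆ {x | ∀ i, a k ≤ x i 0 ∧ x i 0 ≤ T₀} :=
    fun x hx i => ⟨hk8.trans ((hF hx).1 i).1, ((hF hx).1 i).2⟩
  have hHk : tsupport (H : (Fin m → EuclideanSpace ℝ (Fin 4)) → ℂ) ⊆ {x | ∀ i, a k ≤ x i 0 ∧ x i 0 ≤ T₀} :=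
    fun x hx i => ⟨hk8.trans ((hH hx).1 i).1, ((hH hx).1 i).2⟩
  have hKLk := hKL k hk5 n m F H T₀ ((le_max_left _ _).trans hk6) ((le_max_right _ _).trans hk6) hFk hHk
    (⌊t / a k⌋₊) hσ
  rw [hsa k, hsβ k, hsL k] at hk1 hk2 hk3
  -- the uniform bounds at `k`
  have hDF : ‖curvDistribution r sch k (n + n) ((osAdjoint F).appendTensor F)‖ ≤ BF := hDk (n + n) _ hFF
  have hDH : ‖curvDistribution r sch k (m + m) ((osAdjoint H).appendTensor H)‖ ≤ BH := hDk (m + m) _ hHH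
  have hE1 : Real.exp (-(Δ₀ / 2) * t) ≤ 1 := by
    rw [Real.exp_le_one_iff]; nlinarith
  -- the endgame
  refine stub_csclEndgame _ _ _ _ _ _ BF BH _ _ _ (ε / 4) ε₂ ε hk1 hKLk hk2 hk3 (Real.exp_pos _).le hk4 hE1
    (norm_nonneg _) (norm_nonneg _) hDF hDH hε₂.le ?_
  linarith

end Summit.QuantumFields.YangMills.Theorems.ContinuumLegGivenGap

end
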